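import Mathlib
import Literature.ComputerArithmetic.Russinoff2022.BitSlices

/-!
# Russinoff, *Formal Verification of Floating-Point Hardware Design* (2nd ed., 2022), Chapter 2
## §2.3 Concatenation, §2.4 Integer Formats, §2.5 Fixed-Point Formats (printed pp. 23–30)

Source: D. M. Russinoff, *Formal Verification of Floating-Point Hardware Design — A Mathematical
Approach*, 2nd edition, Springer 2022 [cite: Russinoff2022, Chapter 2 (§§2.3–2.5)]. This file
continues `BitSlices.lean` (§§2.1–2.2: `bits` = `x[i:j]`, `bitn` = `x[n]`, `IsBitVector`) with the
remaining three sections of Chapter 2: Definition 2.4 (concatenation `cat`), Lemmas 2.23–2.26,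
Corollary 2.27, Lemmas 2.28–2.29, Corollary 2.30 (§2.3); Definitions 2.5–2.7 (`ui`, `si`,
`sextend`), the two's-complement remark and the sign bit, Lemmas 2.31–2.37 (§2.4); Definition 2.8
(`uf`, `sf`) together with Definition 1.5 (`truncFrac`, the truncation `r^(k)`), Lemma 2.38,
Corollary 2.39 and Lemma 2.40 (§2.5) — every numbered statement of the three sections.

MODEL. As in `BitSlices.lean`: bit vectors are integers `x : ℤ`, indices and widths are natural
numbers, `⌊·⌋` and `mod` are `Int.ediv` / `Int.emod` by the positive divisors `2^j`. A low slice
`x[m−1:0]` is spelled `x % 2^m` (Lemma 2.1 (c); value `0` at `m = 0`, which is what Lemma 2.25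
uses) and `x[p−1:m]` is spelled `x % 2^p / 2^m` (`bits_pred`). `cat x m y n = 2^n·(x mod 2^m) +
y mod 2^n` is the binary case of Definition 2.4; the book's variadic `cat(x₁, n₁, …, x_k, n_k)` is
the iterated binary one and Lemma 2.23 is its associativity. `si` and `sextend` follow Definitions
2.6–2.7 by the same formulas for every integer. Fixed-point values (Definition 2.8) and the
truncations `r^(k)` (Definition 1.5, `k ∈ ℤ`) are rationals: `uf x n m`, `sf x n m : ℚ` with
`m : ℤ` integer bits and the factor `2^(m−n)` an integer power (`zpow`) of `2 : ℚ`.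

OUR READING. (1) ℕ-typed `n − 1`: Lemmas 2.32 and 2.40 carry `0 < n` (Lemma 2.37 is printed for
`n ∈ ℤ⁺` anyway) — with truncated subtraction their `n = 0` instances are false, recorded as
`lemma_2_32_zero_width_fails` and `lemma_2_40_zero_width_fails`; Lemmas 2.31, 2.34, 2.36 and
`sf_eq_ite` hold at `n = 0` as typed and are proved there too (a `0`-bit vector is `0`).
(2) Hypotheses the statements do not need are dropped and this is said at each item: Lemma 2.33
(printed for `x ∈ ℕ`, `j ≤ i`), Lemma 2.35, Lemma 2.38 and Corollary 2.39 (printed for an `n`-bit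
vector `x`) hold for every integer `x`; Lemma 2.29 case 1 holds for every `j`. (3) Lemma 2.29's
five cases are five theorems whose hypotheses are the case conditions; in cases 3 and 5 the slices
`x[m−1:j−n]` and `x[m−1:0]` are spelled `x % 2^m / 2^(j−n)` and `x % 2^m`. (4) Corollary 2.39 is
printed `r^(k) = x ⇔ x[f − k − 1:0] = 0`; its proof (`x[f−k−1:0] = 2^f(r^(f) − r^(k)) =
2^f(r − r^(k))`) establishes `r^(k) = r ⇔ …`, which is what `corollary_2_39` states (with
`k = f − t − 1`, `0 ≤ t < n`, so that `x[f−k−1:0] = x[t:0]`); `corollary_2_39_printed_fails`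
records that the printed form is false, and the first edition (2019, Corollary 2.56, where the
vector is `r` and the value `x`) reads `x^(k) = x ⇔ r[f−k−1:0] = 0`, i.e. our reading.
(5) The proof of Lemma 2.38 in the held copy opens «If r = uf(r, n, m)» — read `uf(x, n, m)`.
(6) Definition 2.8 asks `n ∈ ℤ⁺`; `uf`/`sf` are typed for all `n ∈ ℕ` (at `n = 0`, `x = 0`).

RELATION TO THE TREE. `BoothEncoding.lean` carries `Booth.si` (Definition 2.6 with natural-number
arguments, used by Chapter 9); `si_natCast` proves the two agree on ℕ. `BitVectorAddition.lean`
(Chapter 8) states its integer lemmas for naturals and explicitly does not claim their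
two's-complement instances; nothing there or in `BitSlices.lean` is restated here.

NOT FORMALISED here: the variadic (`k > 2` operands) spelling of Definition 2.4 beyond the
associativity Lemma 2.23, the Verilog-notation remarks of §2.3, and the real-number generality of
Definition 1.5 (typed over `ℚ`, which is where the values of §2.5 live). §2.5 ends with Lemma 2.40
(printed p. 30; the held copy's pp. 30–31 are unreadable scans, the end of the section was
checked against the first edition's §2.5, Lemmas 2.55–2.57 = 2.38–2.40 here).
-/

namespace Literature.ComputerArithmetic.Russinoff2022.BitSlice

/-! ## §2.3 Concatenation -/

/-- [cite: Russinoff2022, Definition 2.4 (§2.3)] `cat(x, m, y, n) = 2^n·x[m-1:0] + y[n-1:0]`,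
the concatenation `{m'x, n'y}`; typed with `x mod 2^m` for `x[m-1:0]` (Lemma 2.1 (c)), which
also gives the intended value `0` at `m = 0` (Lemma 2.25). -/
def cat (x : ℤ) (m : ℕ) (y : ℤ) (n : ℕ) : ℤ := 2 ^ n * (x % 2 ^ m) + y % 2 ^ n

/-- [cite: Russinoff2022, Definition 2.4 (§2.3)] unfolding lemma. -/
theorem cat_def (x : ℤ) (m : ℕ) (y : ℤ) (n : ℕ) :
    cat x m y n = 2 ^ n * (x % 2 ^ m) + y % 2 ^ n := rfl

/-- [cite: Russinoff2022, Definition 2.4 (§2.3)] as printed, with the slices `x[m-1:0]` and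
`y[n-1:0]` of Definition 2.2, for positive widths. -/
theorem cat_eq_bits (x y : ℤ) {m n : ℕ} (hm : 0 < m) (hn : 0 < n) :
    cat x m y n = 2 ^ n * bits x (m - 1) 0 + bits y (n - 1) 0 := by
  rw [cat_def, lemma_2_1_c, lemma_2_1_c, Nat.sub_add_cancel hm, Nat.sub_add_cancel hn]

/-- [cite: Russinoff2022, Lemma 2.1 (a) (§2.1)] the reduced operand `x mod 2^m` is an `m`-bit
vector. -/
theorem emod_isBitVector (x : ℤ) (m : ℕ) : IsBitVector (x % 2 ^ m) m :=
  ⟨Int.emod_nonneg _ (by positivity), Int.emod_lt_of_pos _ (by positivity)⟩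

/-- [cite: Russinoff2022, Lemma 2.24 (§2.3)] `cat(x, m, y, n)` is an `(m+n)`-bit vector. -/
theorem lemma_2_24 (x y : ℤ) (m n : ℕ) : IsBitVector (cat x m y n) (m + n) := by
  obtain ⟨hx0, hx⟩ := emod_isBitVector x m
  obtain ⟨hy0, hy⟩ := emod_isBitVector y n
  refine ⟨by rw [cat_def]; positivity, ?_⟩
  rw [cat_def, pow_add]
  have h1 : 2 ^ n * (x % 2 ^ m) ≤ 2 ^ n * (2 ^ m - 1) :=
    mul_le_mul_of_nonneg_left (by omega) (by positivity)
  have h2 : (2 : ℤ) ^ n * (2 ^ m - 1) + 2 ^ n = 2 ^ m * 2 ^ n := by ring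
  omega

/-- [cite: Russinoff2022, Lemma 2.25 (§2.3)] the trivial cases `cat(x, m, y, 0) = x[m-1:0]` and
`cat(x, 0, y, n) = cat(0, m, y, n) = y[n-1:0]`. -/
theorem lemma_2_25 (x y : ℤ) (m n : ℕ) :
    cat x m y 0 = x % 2 ^ m ∧ cat x 0 y n = y % 2 ^ n ∧ cat 0 m y n = y % 2 ^ n := by
  refine ⟨?_, ?_, ?_⟩
  · rw [cat_def, pow_zero, one_mul, Int.emod_one, add_zero]
  · rw [cat_def, pow_zero, Int.emod_one, mul_zero, zero_add]
  · rw [cat_def, Int.zero_emod, mul_zero, zero_add]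

/-- [cite: Russinoff2022, Lemma 2.23 (§2.3)] associativity:
`cat(cat(x, m, y, n), m+n, z, p) = cat(x, m, cat(y, n, z, p), n+p)` (the book's
`cat(x, m, y, n, z, p)` is the right-nested form by Definition 2.4). -/
theorem lemma_2_23 (x y z : ℤ) (m n p : ℕ) :
    cat (cat x m y n) (m + n) z p = cat x m (cat y n z p) (n + p) := by
  obtain ⟨h1, h2⟩ := lemma_2_24 x y m n
  obtain ⟨h3, h4⟩ := lemma_2_24 y z n p
  rw [cat_def (cat x m y n), Int.emod_eq_of_lt h1 h2, cat_def x m (cat y n z p),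
    Int.emod_eq_of_lt h3 h4, cat_def, cat_def, pow_add]
  ring

/-- [cite: Russinoff2022, Lemma 2.28 (§2.3)] low part: `z[n-1:0] = y[n-1:0]` for
`z = {m'x, n'y}`, typed as `z mod 2^n = y mod 2^n`. -/
theorem lemma_2_28_lo (x y : ℤ) (m n : ℕ) : cat x m y n % 2 ^ n = y % 2 ^ n := by
  rw [cat_def, Int.add_comm, Int.add_mul_emod_self_left, Int.emod_emod_of_dvd _ dvd_rfl]

/-- [cite: Russinoff2022, Lemma 2.28 (§2.3), proof] `⌊z / 2^n⌋ = x[m-1:0]`. -/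
theorem cat_ediv (x y : ℤ) (m n : ℕ) : cat x m y n / 2 ^ n = x % 2 ^ m := by
  obtain ⟨hy0, hy⟩ := emod_isBitVector y n
  rw [cat_def, Int.add_comm, Int.add_mul_ediv_left _ _ (by positivity),
    Int.ediv_eq_zero_of_lt hy0 hy, zero_add]

/-- [cite: Russinoff2022, Lemma 2.28 (§2.3)] high part: `z[n+m-1:n] = x[m-1:0]` for
`z = {m'x, n'y}` and `m ≥ 1`. -/
theorem lemma_2_28_hi (x y : ℤ) {m : ℕ} (hm : 0 < m) (n : ℕ) :
    bits (cat x m y n) (n + m - 1) n = x % 2 ^ m := by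
  obtain ⟨h1, h2⟩ := lemma_2_24 x y m n
  rw [bits_def, show n + m - 1 + 1 = m + n by omega, Int.emod_eq_of_lt h1 h2, cat_ediv]

/-- [cite: Russinoff2022, Lemma 2.29 (§2.3), case 1] `z[i:j] = y[i:j]` if `n > i`. -/
theorem lemma_2_29_case1 (x y : ℤ) (m : ℕ) {n i : ℕ} (hi : i < n) (j : ℕ) :
    bits (cat x m y n) i j = bits y i j := by
  apply lemma_2_1_b
  have hdvd : (2 : ℤ) ^ (i + 1) ∣ 2 ^ n := pow_dvd_pow 2 (by omega)
  have h1 : 2 ^ n * (x % 2 ^ m) ≡ 0 [ZMOD 2 ^ (i + 1)] :=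
    Int.modEq_zero_iff_dvd.2 (dvd_mul_of_dvd_left hdvd _)
  have h2 : y % 2 ^ n ≡ y [ZMOD 2 ^ (i + 1)] := by
    rw [Int.ModEq, Int.emod_emod_of_dvd _ hdvd]
  rw [cat_def]
  simpa using h1.add h2

/-- [cite: Russinoff2022, Lemma 2.29 (§2.3), case 2] `z[i:j] = x[i-n:j-n]` if
`m + n > i ≥ j ≥ n`. -/
theorem lemma_2_29_case2 (x y : ℤ) {m n i j : ℕ} (hi : i < m + n) (hj : n ≤ j) (hij : j ≤ i) :
    bits (cat x m y n) i j = bits x (i - n) (j - n) := by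
  have e := lemma_2_11 (cat x m y n) (i - n) (j - n) n
  rw [Nat.sub_add_cancel hj, Nat.sub_add_cancel (le_trans hj hij), cat_ediv] at e
  rw [← e]
  apply lemma_2_1_b
  rw [Int.ModEq, Int.emod_emod_of_dvd _ (pow_dvd_pow 2 (by omega))]

/-- [cite: Russinoff2022, Lemma 2.29 (§2.3), case 3] `z[i:j] = x[m-1:j-n]` if `i ≥ m + n` and
`j ≥ n`, typed as `⌊(x mod 2^m) / 2^(j-n)⌋` (which is `x[m-1:j-n]` for `m ≥ 1` and `0` for
`m = 0`). -/
theorem lemma_2_29_case3 (x y : ℤ) {m n i j : ℕ} (hi : m + n ≤ i) (hj : n ≤ j) :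
    bits (cat x m y n) i j = x % 2 ^ m / 2 ^ (j - n) := by
  have e := lemma_2_11 (cat x m y n) (i - n) (j - n) n
  rw [Nat.sub_add_cancel hj, Nat.sub_add_cancel (by omega), cat_ediv] at e
  obtain ⟨h1, h2⟩ := emod_isBitVector x m
  rw [← e, bits_def, Int.emod_eq_of_lt h1 (lt_of_lt_of_le h2 ?_)]
  exact pow_le_pow_right₀ (by norm_num) (by omega)

/-- [cite: Russinoff2022, Lemma 2.29 (§2.3), case 4] `z[i:j] = {x[i-n:0], y[n-1:j]}` if
`m + n > i ≥ n > j`. -/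
theorem lemma_2_29_case4 (x y : ℤ) {m n i j : ℕ} (hi : i < m + n) (hin : n ≤ i) (hj : j < n) :
    bits (cat x m y n) i j = cat (bits x (i - n) 0) (i - n + 1) (bits y (n - 1) j) (n - j) := by
  rw [lemma_2_10 (cat x m y n) hj.le hin, lemma_2_29_case2 x y hi le_rfl hin, Nat.sub_self,
    lemma_2_28_lo, ← bits_pred (by omega : 0 < n) y j, cat_def]
  obtain ⟨h1, h2⟩ := bits_nonneg_lt x (i := i - n) (j := 0) (by omega)
  obtain ⟨h3, h4⟩ := bits_nonneg_lt y (i := n - 1) (j := j) (by omega)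
  rw [Nat.sub_zero] at h2
  rw [show n - 1 + 1 - j = n - j by omega] at h4
  rw [Int.emod_eq_of_lt h1 h2, Int.emod_eq_of_lt h3 h4]

/-- [cite: Russinoff2022, Lemma 2.29 (§2.3), case 5] `z[i:j] = {x[m-1:0], y[n-1:j]}` if
`i ≥ n + m` and `n > j`. -/
theorem lemma_2_29_case5 (x y : ℤ) {m n i j : ℕ} (hi : m + n ≤ i) (hj : j < n) :
    bits (cat x m y n) i j = cat (x % 2 ^ m) m (bits y (n - 1) j) (n - j) := by
  rw [lemma_2_10 (cat x m y n) hj.le (by omega : n ≤ i), lemma_2_29_case3 x y hi le_rfl,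
    Nat.sub_self, pow_zero, Int.ediv_one, lemma_2_28_lo, ← bits_pred (by omega : 0 < n) y j,
    cat_def, Int.emod_emod_of_dvd _ dvd_rfl]
  obtain ⟨h3, h4⟩ := bits_nonneg_lt y (i := n - 1) (j := j) (by omega)
  rw [show n - 1 + 1 - j = n - j by omega] at h4
  rw [Int.emod_eq_of_lt h3 h4]

/-- [cite: Russinoff2022, Corollary 2.30 (§2.3)] the bits of a concatenation:
`{m'x, n'y}[i] = y[i]` (`i < n`), `x[i-n]` (`n ≤ i < m+n`), `0` (`n+m ≤ i`). -/
theorem corollary_2_30 (x y : ℤ) (m n i : ℕ) :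
    bitn (cat x m y n) i =
      if i < n then bitn y i else if i < m + n then bitn x (i - n) else 0 := by
  split_ifs with h1 h2
  · exact lemma_2_29_case1 x y m h1 i
  · exact lemma_2_29_case2 x y h2 (not_lt.mp h1) le_rfl
  · obtain ⟨hz0, hz⟩ := lemma_2_24 x y m n
    exact lemma_2_16_d ⟨hz0, lt_of_lt_of_le hz (pow_le_pow_right₀ (by norm_num) (by omega))⟩

/-- [cite: Russinoff2022, Lemma 2.26 (§2.3)] «a restatement of Lemma 2.10»:
`x[n:m] = {x[n:p], x[p-1:m]}` for `m ≤ p ≤ n` (the low operand typed `⌊(x mod 2^p)/2^m⌋`). -/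
theorem lemma_2_26 (x : ℤ) {m p n : ℕ} (hmp : m ≤ p) (hpn : p ≤ n) :
    bits x n m = cat (bits x n p) (n + 1 - p) (x % 2 ^ p / 2 ^ m) (p - m) := by
  rw [lemma_2_10 x hmp hpn, cat_def]
  obtain ⟨h1, h2⟩ := bits_nonneg_lt x (i := n) (j := p) (by omega)
  obtain ⟨h3, h4⟩ := emod_isBitVector x p
  have h5 : 0 ≤ x % 2 ^ p / 2 ^ m := Int.ediv_nonneg h3 (by positivity)
  have h6 : x % 2 ^ p / 2 ^ m < 2 ^ (p - m) := by
    apply Int.ediv_lt_of_lt_mul (by positivity)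
    rw [← pow_add, Nat.sub_add_cancel hmp]
    exact h4
  rw [Int.emod_eq_of_lt h1 h2, Int.emod_eq_of_lt h5 h6]

/-- [cite: Russinoff2022, Corollary 2.27 (§2.3)] `x[n:m] = {x[n], x[n-1:m]} = {x[n:m+1], x[m]}`
for `m ≤ n`. -/
theorem corollary_2_27 (x : ℤ) {m n : ℕ} (h : m ≤ n) :
    bits x n m = cat (bitn x n) 1 (x % 2 ^ n / 2 ^ m) (n - m) ∧
      bits x n m = cat (bits x n (m + 1)) (n - m) (bitn x m) 1 := by
  constructor
  · have e := lemma_2_26 x h le_rfl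
    rwa [show n + 1 - n = 1 by omega] at e
  · rw [(lemma_2_16_k x h).2, cat_def, pow_one]
    obtain ⟨h1, h2⟩ := bits_nonneg_lt x (i := n) (j := m + 1) (by omega)
    rw [show n + 1 - (m + 1) = n - m by omega] at h2
    have hb : bitn x m % 2 = bitn x m := by
      rcases lemma_2_16_a x m with h0 | h0 <;> rw [h0] <;> norm_num
    rw [Int.emod_eq_of_lt h1 h2, hb]
    ring

/-! ## §2.4 Integer Formats -/

/-- [cite: Russinoff2022, Definition 2.5 (§2.4)] the unsigned integer format: «the bit vectors
of width n, are represented by themselves under the identity mapping», `ui(x, n) = x`; typed by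
the same formula for every integer `x` (the width argument is carried but unused). -/
def ui (x : ℤ) (_n : ℕ) : ℤ := x

/-- [cite: Russinoff2022, Definition 2.5 (§2.4)] unfolding lemma. -/
theorem ui_def (x : ℤ) (n : ℕ) : ui x n = x := rfl

/-- [cite: Russinoff2022, Definition 2.6 (§2.4)] the signed integer («two's complement»)
value of an `n`-bit vector: `si(x, n) = x − 2^n` if `x[n−1] = 1` and `si(x, n) = x` if
`x[n−1] = 0`; typed by the same case split for every integer `x` (Lemma 2.16 (a): the bit is
`0` or `1`), with `x[n-1]` the ℕ-indexed `bitn x (n - 1)` (so at `n = 0` the test reads `x[0]`). -/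
def si (x : ℤ) (n : ℕ) : ℤ := if bitn x (n - 1) = 1 then x - 2 ^ n else x

/-- [cite: Russinoff2022, Definition 2.6 (§2.4)] unfolding lemma. -/
theorem si_def (x : ℤ) (n : ℕ) : si x n = if bitn x (n - 1) = 1 then x - 2 ^ n else x := rfl

/-- [cite: Russinoff2022, Definition 2.6 (§2.4)] agreement with the ℕ-argument typing
`Booth.si` of the same definition (file `BoothEncoding`). -/
theorem si_natCast (x n : ℕ) : si (x : ℤ) n = Booth.si x n := by
  simp [si_def, Booth.si, bitn_natCast]

/-- [cite: Russinoff2022, §2.4 (two's complement remark)] if `0 < x < 2^(n−1)` «then the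
encoding of -x is the complement of x with respect to» `2^n`: `x + (−x)[n−1:0] = 2^n`, with
`(−x)[n−1:0]` spelled `(-x) mod 2^n` (Lemma 2.1 (c)). -/
theorem twos_complement {x : ℤ} {n : ℕ} (h0 : 0 < x) (h : x < 2 ^ (n - 1)) :
    x + -x % 2 ^ n = 2 ^ n := by
  have h1 : (2 : ℤ) ^ (n - 1) ≤ 2 ^ n := pow_le_pow_right₀ (by norm_num) (Nat.sub_le n 1)
  rw [← Int.add_mul_emod_self_left (-x) (2 ^ n) 1, mul_one,
    Int.emod_eq_of_lt (by linarith) (by linarith)]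
  ring

/-- [cite: Russinoff2022, §2.4 (the sign bit)] for an `n`-bit vector `x` with `n > 0`, the most
significant bit `x[n−1]` (which «is therefore considered the *sign bit* of the encoding») is `0`
iff `x < 2^(n−1)` (Lemma 2.16 (d)) and `1` iff `2^(n−1) ≤ x` (Corollary 2.18). -/
theorem sign_bit_eq_one_iff {x : ℤ} {n : ℕ} (hn : 0 < n) (h : IsBitVector x n) :
    bitn x (n - 1) = 1 ↔ 2 ^ (n - 1) ≤ x := by
  constructor
  · intro hb
    by_contra hlt
    have h0 : bitn x (n - 1) = 0 := lemma_2_16_d ⟨h.1, lt_of_not_ge hlt⟩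
    omega
  · intro hle
    exact corollary_2_18 hle (by rw [Nat.sub_add_cancel hn]; exact h.2)

/-- [cite: Russinoff2022, Definition 2.6 (§2.4)] a `0`-bit vector is `0`, and `si(0, n) = 0`. -/
theorem si_zero (n : ℕ) : si 0 n = 0 := by
  simp [si_def, bitn_def]

/-- [cite: Russinoff2022, Lemma 2.31 (§2.4)] «If x is an n-bit vector, then»
`−2^(n−1) ≤ si(x, n) < 2^(n−1)` (at `n = 0`, where `x = 0`, the ℕ-typed exponent `n − 1` reads
`0` and the claim is `−1 ≤ 0 < 1`). -/
theorem lemma_2_31 {x : ℤ} {n : ℕ} (h : IsBitVector x n) :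
    -2 ^ (n - 1) ≤ si x n ∧ si x n < 2 ^ (n - 1) := by
  rcases Nat.eq_zero_or_pos n with rfl | hn
  · obtain ⟨h0, h1⟩ := h
    rw [pow_zero] at h1
    obtain rfl : x = 0 := by omega
    rw [si_zero]
    norm_num
  · have key := sign_bit_eq_one_iff hn h
    have h2 : (2 : ℤ) ^ n = 2 * 2 ^ (n - 1) := by
      rw [← pow_succ', Nat.sub_add_cancel hn]
    obtain ⟨h0, h1⟩ := h
    rw [si_def]
    split_ifs with hb
    · have h3 := key.1 hb
      constructor <;> linarith
    · have h3 : x < 2 ^ (n - 1) := lt_of_not_ge fun hle => hb (key.2 hle)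
      constructor <;> linarith [pow_pos (show (0 : ℤ) < 2 from two_pos) (n - 1)]

/-- [cite: Russinoff2022, Lemma 2.32 (§2.4)] if `−2^(n−1) ≤ x < 2^(n−1)` then
`si(x[n−1:0], n) = x`, with `x[n−1:0]` spelled `x mod 2^n`; typed for `n > 0` (with the ℕ-typed
exponent `n − 1`, the instance `n = 0`, `x = −1` of the printed range would read `si(0, 0) = −1`,
which is false). -/
theorem lemma_2_32 {x : ℤ} {n : ℕ} (hn : 0 < n) (hlo : -2 ^ (n - 1) ≤ x) (hhi : x < 2 ^ (n - 1)) :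
    si (x % 2 ^ n) n = x := by
  have h2 : (2 : ℤ) ^ n = 2 * 2 ^ (n - 1) := by
    rw [← pow_succ', Nat.sub_add_cancel hn]
  rw [si_def]
  rcases le_or_gt 0 x with hx | hx
  · rw [Int.emod_eq_of_lt hx (by linarith), lemma_2_16_d ⟨hx, hhi⟩]
    simp
  · rw [← Int.add_mul_emod_self_left x (2 ^ n) 1, mul_one,
      Int.emod_eq_of_lt (by linarith) (by linarith),
      corollary_2_18 (by linarith) (by rw [Nat.sub_add_cancel hn]; linarith)]
    simp

/-- [cite: Russinoff2022, Lemma 2.32 (§2.4)] the zero-width corner excluded by `0 < n` in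
`lemma_2_32`: with ℕ-typed `n − 1`, `n = 0` and `x = −1` satisfy the printed range
`−2^(n−1) ≤ x < 2^(n−1)` but `si((−1) mod 2^0, 0) = 0 ≠ −1`. -/
theorem lemma_2_32_zero_width_fails : si ((-1) % 2 ^ 0) 0 ≠ -1 := by decide

/-- [cite: Russinoff2022, Lemma 2.33 (§2.4)] «si(x, n)[i : j] = x[i : j]» for `j ≤ i < n`; typed
for every integer `x` and every `j` (the book takes `x ∈ ℕ` and `j ≤ i`; by Lemma 2.1 (b), since
`si(x, n) ≡ x (mod 2^n)`). -/
theorem lemma_2_33 (x : ℤ) {i n : ℕ} (hi : i < n) (j : ℕ) : bits (si x n) i j = bits x i j := by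
  rw [si_def]
  split_ifs
  · refine lemma_2_1_b (Int.modEq_iff_dvd.2 ?_) j
    rw [show x - (x - 2 ^ n) = 2 ^ n by ring]
    exact pow_dvd_pow 2 hi
  · rfl

/-- [cite: Russinoff2022, Lemma 2.34 (§2.4)] if `n ∈ ℕ`, `k ∈ ℕ` and `x` is an `n`-bit vector then
`si(2^k·x, k+n) = 2^k·si(x, n)` («follows easily from Definition 2.6 and Lemma 2.16 (h)»). -/
theorem lemma_2_34 {x : ℤ} {n : ℕ} (h : IsBitVector x n) (k : ℕ) :
    si (2 ^ k * x) (k + n) = 2 ^ k * si x n := by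
  rcases Nat.eq_zero_or_pos n with rfl | hn
  · obtain ⟨h0, h1⟩ := h
    rw [pow_zero] at h1
    obtain rfl : x = 0 := by omega
    rw [mul_zero, si_zero, si_zero, mul_zero]
  · rw [si_def, si_def, show k + n - 1 = n - 1 + k by omega, lemma_2_16_h]
    split_ifs <;> ring

/-- [cite: Russinoff2022, Lemma 2.35 (§2.4)] for `n > m`,
`si(x, n) = 2^m·si(⌊x/2^m⌋, n − m) + x mod 2^m`; typed for every integer `x` (the book assumes
an `n`-bit vector; both sides are keyed on the same bit `x[n−1] = ⌊x/2^m⌋[n−m−1]`,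
Lemma 2.16 (i)). -/
theorem lemma_2_35 (x : ℤ) {m n : ℕ} (hmn : m < n) :
    si x n = 2 ^ m * si (x / 2 ^ m) (n - m) + x % 2 ^ m := by
  obtain ⟨d, rfl⟩ := Nat.exists_eq_add_of_lt hmn
  rw [si_def, si_def, show m + d + 1 - m - 1 = d by omega, show m + d + 1 - 1 = d + m by omega,
    lemma_2_16_i, show m + d + 1 - m = d + 1 by omega]
  have e := Int.mul_ediv_add_emod x (2 ^ m)
  split_ifs
  · linear_combination -e
  · linear_combination -e

/-- [cite: Russinoff2022, Definition 2.7 (§2.4)] sign extension of an `n`-bit encoding to `m ≥ n`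
bits: `sextend(m, n, x) = si(x, n)[m−1:0]`, with the slice spelled `si(x, n) mod 2^m`
(Lemma 2.1 (c)). -/
def sextend (m n : ℕ) (x : ℤ) : ℤ := si x n % 2 ^ m

/-- [cite: Russinoff2022, Definition 2.7 (§2.4)] unfolding lemma. -/
theorem sextend_def (m n : ℕ) (x : ℤ) : sextend m n x = si x n % 2 ^ m := rfl

/-- [cite: Russinoff2022, Lemma 2.36 (a) (§2.4)] for an `n`-bit vector `x` and `m ≥ n`:
`sextend(m, n, x) = x` if `x[n−1] = 0` and `= x + 2^m − 2^n` if `x[n−1] = 1`. -/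
theorem lemma_2_36_a {x : ℤ} {m n : ℕ} (h : IsBitVector x n) (hnm : n ≤ m) :
    sextend m n x = if bitn x (n - 1) = 1 then x + 2 ^ m - 2 ^ n else x := by
  have hpow : (2 : ℤ) ^ n ≤ 2 ^ m := pow_le_pow_right₀ (by norm_num) hnm
  rw [sextend_def, si_def]
  split_ifs with hb
  · have hn : 0 < n := by
      rcases Nat.eq_zero_or_pos n with rfl | hn
      · obtain ⟨h0, h1⟩ := h
        rw [pow_zero] at h1
        obtain rfl : x = 0 := by omega
        rw [bitn_def] at hb
        norm_num at hb
      · exact hn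
    have h3 := (sign_bit_eq_one_iff hn h).1 hb
    rw [← Int.add_mul_emod_self_left (x - 2 ^ n) (2 ^ m) 1, mul_one,
      Int.emod_eq_of_lt (by linarith [h.1]) (by linarith [h.2])]
    ring
  · exact Int.emod_eq_of_lt h.1 (lt_of_lt_of_le h.2 hpow)

/-- [cite: Russinoff2022, Lemma 2.36 (b) (§2.4)] «A sign extension of an integer encoding x
represents the same value as x»: `si(sextend(m, n, x), m) = si(x, n)` for an `n`-bit vector `x`
and `m ≥ n`. -/
theorem lemma_2_36_b {x : ℤ} {m n : ℕ} (h : IsBitVector x n) (hnm : n ≤ m) :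
    si (sextend m n x) m = si x n := by
  rw [lemma_2_36_a h hnm, si_def x n]
  rcases Nat.eq_zero_or_pos n with rfl | hn
  · obtain ⟨h0, h1⟩ := h
    rw [pow_zero] at h1
    obtain rfl : x = 0 := by omega
    simp [si_zero, bitn_def]
  · have hm : 0 < m := lt_of_lt_of_le hn hnm
    have key := sign_bit_eq_one_iff hn h
    have hp1 : (2 : ℤ) ^ (n - 1) ≤ 2 ^ (m - 1) := pow_le_pow_right₀ (by norm_num) (by omega)
    have h2n : (2 : ℤ) ^ n = 2 * 2 ^ (n - 1) := by rw [← pow_succ', Nat.sub_add_cancel hn]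
    have h2m : (2 : ℤ) ^ m = 2 * 2 ^ (m - 1) := by rw [← pow_succ', Nat.sub_add_cancel hm]
    split_ifs with hb
    · have h3 := key.1 hb
      rw [si_def, corollary_2_18 (by linarith) (by rw [Nat.sub_add_cancel hm]; linarith [h.2]),
        if_pos rfl]
      ring
    · have h3 : x < 2 ^ (n - 1) := lt_of_not_ge fun hle => hb (key.2 hle)
      have h4 : IsBitVector x (m - 1) := ⟨h.1, lt_of_lt_of_le h3 hp1⟩
      rw [si_def, lemma_2_16_d h4]
      simp

/-- [cite: Russinoff2022, Lemma 2.37 (§2.4)] «wrap-around» control for a redundant-form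
approximation `Y` of `X`: if `|si(X mod 2^n, n)| + |X − Y| < 2^(n−1)` (`n ∈ ℤ⁺`) then
`si(X mod 2^n, n) − si(Y mod 2^n, n) = X − Y`. -/
theorem lemma_2_37 {X Y : ℤ} {n : ℕ} (hn : 0 < n)
    (h : |si (X % 2 ^ n) n| + |X - Y| < 2 ^ (n - 1)) :
    si (X % 2 ^ n) n - si (Y % 2 ^ n) n = X - Y := by
  set s := si (X % 2 ^ n) n with hs
  have hc : ∃ c : ℤ, s = X % 2 ^ n - 2 ^ n * c := by
    rw [hs, si_def]
    split_ifs
    · exact ⟨1, by ring⟩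
    · exact ⟨0, by ring⟩
  obtain ⟨c, hc⟩ := hc
  have hmod : (s + Y - X) % 2 ^ n = Y % 2 ^ n := by
    have e := Int.mul_ediv_add_emod X (2 ^ n)
    have : s + Y - X = Y + 2 ^ n * (-(X / 2 ^ n) - c) := by linear_combination hc + e
    rw [this, Int.add_mul_emod_self_left]
  have hab : |s + (Y - X)| ≤ |s| + |Y - X| := abs_add_le _ _
  rw [abs_sub_comm X Y] at h
  obtain ⟨hlo, hhi⟩ := abs_lt.1 (lt_of_le_of_lt hab h)
  have key := lemma_2_32 hn (x := s + Y - X) (by linarith) (by linarith)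
  rw [hmod] at key
  linarith

/-! ## §2.5 Fixed-Point Formats -/

/-- [cite: Russinoff2022, Definition 1.5 (§1.1)] truncation to `k` fractional bits,
`r^(k) = ⌊2^k·r⌋ / 2^k` for `k ∈ ℤ` (the book takes `r ∈ ℝ`; the fixed-point values of §2.5 are
rational, so it is typed over `ℚ` here). -/
def truncFrac (r : ℚ) (k : ℤ) : ℚ := (⌊(2 : ℚ) ^ k * r⌋ : ℚ) / (2 : ℚ) ^ k

/-- [cite: Russinoff2022, Definition 1.5 (§1.1)] unfolding lemma. -/
theorem truncFrac_def (r : ℚ) (k : ℤ) :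
    truncFrac r k = (⌊(2 : ℚ) ^ k * r⌋ : ℚ) / (2 : ℚ) ^ k := rfl

/-- [cite: Russinoff2022, Definition 2.8 (a) (§2.5)] the unsigned fixed-point value of an `n`-bit
vector with `m` integer bits, `uf(x, n, m) = 2^(m−n)·ui(x) = 2^(m−n)·x` («while n must be
positive, there is no restriction on m»; typed for all `n ∈ ℕ`, `m ∈ ℤ`). -/
def uf (x : ℤ) (n : ℕ) (m : ℤ) : ℚ := (2 : ℚ) ^ (m - n) * (ui x n : ℚ)

/-- [cite: Russinoff2022, Definition 2.8 (b) (§2.5)] the signed fixed-point value,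
`sf(x, n, m) = 2^(m−n)·si(x, n)`. -/
def sf (x : ℤ) (n : ℕ) (m : ℤ) : ℚ := (2 : ℚ) ^ (m - n) * (si x n : ℚ)

/-- [cite: Russinoff2022, Definition 2.8 (a) (§2.5)] unfolding lemma: `uf(x, n, m) = 2^(m−n)·x`.
-/
theorem uf_def (x : ℤ) (n : ℕ) (m : ℤ) : uf x n m = (2 : ℚ) ^ (m - n) * x := rfl

/-- [cite: Russinoff2022, Definition 2.8 (b) (§2.5)] unfolding lemma. -/
theorem sf_def (x : ℤ) (n : ℕ) (m : ℤ) : sf x n m = (2 : ℚ) ^ (m - n) * (si x n : ℚ) := rfl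

/-- [cite: Russinoff2022, Definition 2.8 (b) (§2.5)] the printed case form for an `n`-bit vector:
`sf(x, n, m) = 2^(m−n)·x` if `x < 2^(n−1)` and `= 2^(m−n)·x − 2^m` if `x ≥ 2^(n−1)`. -/
theorem sf_eq_ite {x : ℤ} {n : ℕ} (h : IsBitVector x n) (m : ℤ) :
    sf x n m =
      if x < 2 ^ (n - 1) then (2 : ℚ) ^ (m - n) * x else (2 : ℚ) ^ (m - n) * x - 2 ^ m := by
  rcases Nat.eq_zero_or_pos n with rfl | hn
  · obtain ⟨h0, h1⟩ := h
    rw [pow_zero] at h1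
    obtain rfl : x = 0 := by omega
    rw [sf_def, si_zero]
    norm_num
  · have key := sign_bit_eq_one_iff hn h
    rw [sf_def, si_def]
    by_cases hx : x < 2 ^ (n - 1)
    · rw [if_neg (fun hb => absurd (key.1 hb) (not_le.2 hx)), if_pos hx]
    · rw [if_pos (key.2 (not_lt.1 hx)), if_neg hx]
      have e : (2 : ℚ) ^ (m - n) * (2 : ℚ) ^ (n : ℤ) = 2 ^ m := by
        rw [← zpow_add₀ (two_ne_zero), sub_add_cancel]
      rw [zpow_natCast] at e
      push_cast
      linear_combination -e

/-- [cite: Russinoff2022, Definition 1.5 (§1.1) with Lemma 1.1] for an integer `y` and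
`f, t ∈ ℕ`: `(y/2^f)^((f−t)) = ⌊y/2^t⌋ / 2^(f−t)`. -/
theorem truncFrac_intCast_div (y : ℤ) (f t : ℕ) :
    truncFrac ((y : ℚ) / 2 ^ f) ((f : ℤ) - t) =
      ((y / 2 ^ t : ℤ) : ℚ) / (2 : ℚ) ^ ((f : ℤ) - t) := by
  rw [truncFrac_def]
  congr 2
  rw [zpow_sub₀ (two_ne_zero), zpow_natCast, zpow_natCast,
    show (2 : ℚ) ^ f / 2 ^ t * ((y : ℚ) / 2 ^ f) = (y : ℚ) / ((2 ^ t : ℕ) : ℚ) by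
      push_cast; field_simp,
    Rat.floor_intCast_div_natCast]
  push_cast
  rfl

/-- [cite: Russinoff2022, Lemma 2.38 (§2.5), the computation in its proof] for an integer `y`,
`f ∈ ℕ`, `r = y/2^f` and `j ≤ i`: `y[i:j] = 2^(f−j)·(r^((f−j)) − r^((f−i−1)))` («by Lemmas 2.1 (b)
and 2.7»). -/
theorem bits_eq_truncFrac (y : ℤ) (f : ℕ) {i j : ℕ} (hij : j ≤ i) :
    (bits y i j : ℚ) = (2 : ℚ) ^ ((f : ℤ) - j) *
      (truncFrac ((y : ℚ) / 2 ^ f) ((f : ℤ) - j) -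
        truncFrac ((y : ℚ) / 2 ^ f) ((f : ℤ) - i - 1)) := by
  have h1 : (2 : ℚ) ^ ((f : ℤ) - j) ≠ 0 := zpow_ne_zero _ two_ne_zero
  have h1' : (2 : ℚ) ^ ((f : ℤ) - ((i + 1 : ℕ) : ℤ)) ≠ 0 := zpow_ne_zero _ two_ne_zero
  have h2 : (2 : ℚ) ^ ((f : ℤ) - j) =
      (2 : ℚ) ^ (i + 1 - j : ℕ) * (2 : ℚ) ^ ((f : ℤ) - ((i + 1 : ℕ) : ℤ)) := by
    rw [← zpow_natCast, ← zpow_add₀ (two_ne_zero)]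
    congr 1
    rw [Nat.cast_sub (by omega : j ≤ i + 1)]
    push_cast
    ring
  rw [show (f : ℤ) - i - 1 = (f : ℤ) - ((i + 1 : ℕ) : ℤ) by push_cast; ring,
    truncFrac_intCast_div, truncFrac_intCast_div, bits_eq_ediv_sub y (by omega : j ≤ i + 1),
    mul_sub, mul_div_assoc', mul_div_cancel_left₀ _ h1, h2, mul_assoc, mul_div_assoc',
    mul_div_cancel_left₀ _ h1']
  push_cast
  ring

/-- [cite: Russinoff2022, Definition 2.8 (§2.5)] with `f = n − m` fractional bits (`m ≤ n`), a
value `r = uf(x, n, m)` or `r = sf(x, n, m)` is `y/2^f` for an integer `y` (`y = x`, resp.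
`y = si(x, n)`) whose slices below bit `n` are those of `x` (Lemma 2.33). -/
theorem uf_sf_eq_div (x : ℤ) {m n i : ℕ} (hmn : m ≤ n) (hin : i < n) {r : ℚ}
    (hr : r = uf x n m ∨ r = sf x n m) :
    ∃ y : ℤ, r = (y : ℚ) / 2 ^ (n - m) ∧ ∀ j, bits y i j = bits x i j := by
  have hf : (2 : ℚ) ^ ((m : ℤ) - n) = ((2 : ℚ) ^ (n - m))⁻¹ := by
    rw [← zpow_natCast, ← zpow_neg, Nat.cast_sub hmn, neg_sub]
  rcases hr with rfl | rfl
  · exact ⟨x, by rw [uf_def, hf, div_eq_inv_mul], fun j => rfl⟩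
  · exact ⟨si x n, by rw [sf_def, hf, div_eq_inv_mul], fun j => lemma_2_33 x hin j⟩

/-- [cite: Russinoff2022, Lemma 2.38 (§2.5)] for `m ≤ n`, `j ≤ i < n`, `f = n − m` and
`r = uf(x, n, m)` or `r = sf(x, n, m)`: `x[i:j] = 2^(f−j)·(r^((f−j)) − r^((f−i−1)))` («the
following expression for a bit slice of an encoding in terms of the encoded value»); typed for every
integer `x` (the book's `n`-bit hypothesis is not needed). -/
theorem lemma_2_38 (x : ℤ) {m n i j : ℕ} (hmn : m ≤ n) (hij : j ≤ i) (hin : i < n) {r : ℚ}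
    (hr : r = uf x n m ∨ r = sf x n m) :
    (bits x i j : ℚ) = (2 : ℚ) ^ (((n - m : ℕ) : ℤ) - j) *
      (truncFrac r (((n - m : ℕ) : ℤ) - j) - truncFrac r (((n - m : ℕ) : ℤ) - i - 1)) := by
  obtain ⟨y, rfl, hy⟩ := uf_sf_eq_div x hmn hin hr
  rw [← hy j]
  exact bits_eq_truncFrac y (n - m) hij

/-- [cite: Russinoff2022, Corollary 2.39 (§2.5)] with `f = n − m` and `f − n ≤ k < f`:
`r^((k)) = r ⇔ x[f−k−1:0] = 0`; typed with `k = f − t − 1`, `0 ≤ t < n`, so that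
`x[f−k−1:0] = x[t:0] = x mod 2^(t+1)` (as printed the left side reads `r^((k)) = x`; the proof,
`x[f−k−1:0] = 2^f(r^((f)) − r^((k))) = 2^f(r − r^((k)))`, establishes `r^((k)) = r`). -/
theorem corollary_2_39 (x : ℤ) {m n t : ℕ} (hmn : m ≤ n) (ht : t < n) {r : ℚ}
    (hr : r = uf x n m ∨ r = sf x n m) :
    truncFrac r (((n - m : ℕ) : ℤ) - t - 1) = r ↔ x % 2 ^ (t + 1) = 0 := by
  obtain ⟨y, rfl, hy⟩ := uf_sf_eq_div x hmn ht hr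
  have e := bits_eq_truncFrac y (n - m) (Nat.zero_le t)
  have e0 : truncFrac ((y : ℚ) / 2 ^ (n - m)) (((n - m : ℕ) : ℤ) - ((0 : ℕ) : ℤ)) =
      (y : ℚ) / 2 ^ (n - m) := by
    rw [truncFrac_intCast_div, pow_zero, Int.ediv_one, Nat.cast_zero, sub_zero, zpow_natCast]
  rw [e0, hy 0, lemma_2_1_c] at e
  have h1 : (2 : ℚ) ^ (((n - m : ℕ) : ℤ) - ((0 : ℕ) : ℤ)) ≠ 0 := zpow_ne_zero _ two_ne_zero
  constructor
  · intro hk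
    rw [hk, sub_self, mul_zero] at e
    exact_mod_cast e
  · intro hx
    rw [hx, Int.cast_zero, eq_comm, mul_eq_zero, sub_eq_zero] at e
    rcases e with e | e
    · exact absurd e h1
    · exact e.symm

/-- [cite: Russinoff2022, Corollary 2.39 (§2.5)] the statement AS PRINTED, `r^((k)) = x ⇔
x[f−k−1:0] = 0`, fails: `n = 2`, `m = 0` (`f = 2`), `k = 1`, the 2-bit vector `x = 2` and
`r = uf(2, 2, 0) = 1/2` give `r^((1)) = 1/2 ≠ 2 = x` while `x[0:0] = 2 mod 2 = 0`. -/
theorem corollary_2_39_printed_fails :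
    ¬ (truncFrac (uf 2 2 0) 1 = ((2 : ℤ) : ℚ) ↔ (2 : ℤ) % 2 ^ (0 + 1) = 0) := by
  norm_num [truncFrac_def, uf_def, ui_def]

/-- [cite: Russinoff2022, Lemma 2.40 (§2.5)] «useful in determining the value of a fixed-point
encoding»: if `x` is an `n`-bit vector, `r = sf(x, n, m)`, `x ≡ y (mod 2^n)` and
`−2^(n−1) ≤ y < 2^(n−1)`, then `r = 2^(m−n)·y`; typed for `n > 0` and every `m ∈ ℤ` (with the
ℕ-typed exponent `n − 1`, the instance `n = 0`, `x = 0`, `y = −1` would be false). -/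
theorem lemma_2_40 {x y : ℤ} {n : ℕ} (hn : 0 < n) (h : IsBitVector x n) (hxy : x ≡ y [ZMOD 2 ^ n])
    (hlo : -2 ^ (n - 1) ≤ y) (hhi : y < 2 ^ (n - 1)) (m : ℤ) :
    sf x n m = (2 : ℚ) ^ (m - n) * y := by
  have hx : x = y % 2 ^ n := by rw [← Int.emod_eq_of_lt h.1 h.2]; exact hxy
  rw [sf_def, hx, lemma_2_32 hn hlo hhi]

/-- [cite: Russinoff2022, Lemma 2.40 (§2.5)] the zero-width corner excluded by `0 < n` in
`lemma_2_40`: `n = 0`, `x = 0`, `y = −1`, `m = 0` satisfy the ℕ-typed hypotheses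
(`x ≡ y (mod 1)`, `−2^0 ≤ −1 < 2^0`) but `sf(0, 0, 0) = 0 ≠ 2^0·(−1)`. -/
theorem lemma_2_40_zero_width_fails :
    IsBitVector 0 0 ∧ (0 : ℤ) ≡ -1 [ZMOD 2 ^ 0] ∧
      sf 0 0 0 ≠ (2 : ℚ) ^ ((0 : ℤ) - (0 : ℕ)) * (-1 : ℤ) := by
  refine ⟨⟨le_rfl, by norm_num⟩, by decide, ?_⟩
  rw [sf_def, si_zero]
  norm_num

end Literature.ComputerArithmetic.Russinoff2022.BitSlice
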